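import Summits.ABC.IUTFork.Cor312GenuineKWildExact
import Summits.ABC.IUTFork.Cor312GenuineKWildDifferent
import Literature.IUT.LogVolume.SubThetaFieldRamificationSplit
import Literature.NumberTheory.EllipticCurves.TateParameterPthPowerOfJProofs
import HarnessLib

/-!
# [IUTchIII] Cor. 3.12, branch C / R-W window table — the EXACT wild local type at a SPLIT packet:
# `e(K_{x₀}/ℚ_p) = (p − 1)·(p′/gcd(p′, t))·l` — NO wild factor `p` — at every fibre point `x₀ ∣ p ∈ {3, 5}` over a
# pole of `j` of order `2t` with `p ∣ t` and `u^{p−1} ≡ 1 (mod p²)`, `u = j⁻¹p^{−2t}` (`{p, p′} = {3, 5}`, `p ≠ l`)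

PROOF-ONLY support file (D-0012; 0 definitions, 0 `Prop` facts) of the abc-iut cell (R-W «WINDOW Θ-SIDE INEQUALITY», seat
abc-iut-W-neg-1 gen 3; GAP G-Wnum2-1 (i), the SPLIT residual left open by gen 2's `Cor312GenuineKWildExact` (W1, `p ∤ t`) and
`Cor312GenuineKWildExactUnit` (W2, `p ∣ t`, `u^{p−1} ≢ 1 (mod p²)`)). TAKES NO SIDE on [IUTchIII] Cor. 3.12
(S. Mochizuki, *Inter-universal Teichmüller theory III*, Cor. 3.12 p. 173–174) or on any author.

At a SPLIT packet — `p ∣ t` AND the unit criterion `u^{p−1} ≡ 1 (mod p²)` for the rational unit part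
`u = (j(q₀)⁻¹)/p^{2t}` — the `ℚ_p`-Tate parameter `q` of `E_λ` (`|q|_p = p^{−2t}`, `q ≡ j⁻¹ (mod q²)`) is a `p`-TH POWER IN
`ℚ_p` (Serre, *Cours d'arithmétique* II §3.3: `p^k w ∈ (ℚ_p^×)^p ⟺ p ∣ k ∧ w^{p−1} ≡ 1 (p²)`; this seat's
`exists_pow_prime_eq_of_tateJ_eq_adicCompletion_rat`), so the Kummer class of `q` VANISHES, `ℚ_p(E′[p]) ⊆ ℚ_p^{nr}(ζ_p)` for
every multiplicative twist `E′`, and the inertia chain of the layer `F/ℚ` has no index-`p` step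
(`Cor22.ramificationIdx_subThetaField_dvd_split`: `e(w | p) ∣ (p−1)·p′`, resp. `∣ p − 1` when `p′ ∣ t`). Against the LOWER
divisibilities `(p − 1) ∣ e(w | p)` (`μ₃₀ ⊂ F`) and `15 ∣ e(w | p)·t` (the `30`-th root of the Tate parameter) this pins

* `GenuineK.ramificationIdx_F_eq_wildSplit_ratPoint` — **`e(w | p) = (p − 1)·(p′/gcd(p′, t))`** for every place `w ∣ p`
  of `F`;
* **`GenuineK.absRamificationIdx_kOf_eq_wildSplit_ratPoint`** — **`e(K_{x₀}/ℚ_p) = (p − 1)·(p′/gcd(p′, t))·l`** at every fibre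
  point `x₀ ∣ p` of the pilot datum (the `l`-division layer contributes exactly `l`,
  `GenuineK.absRamificationIdx_kOf_eq_mul_prime_ratPoint`);

i.e. W-num-2's `e_w = l·e_W·r` with `e_W = p − 1` (NOT `p(p−1)`) at the SPLIT pole pairs of W2-POLES — the smaller of the two
candidates `{(p−1)rl, p(p−1)rl}` left by gen 2, now decided; there the different is TAME, `ord 𝔇 = e − 1`.

HONEST FRAMING: bookkeeping over OUR typed objects (classical Tate-curve and local-field theory); nothing here bears on the
printed inequality of [IUTchIII] Cor. 3.12 or on the number-level `Cor22.Cor312AtDatum`; typed ≠ proved; instantiated ≠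
endorsed. [cite: Serre1972, §1.11–§1.12] [cite: Serre1973, Ch. II §3.3] [cite: SilvermanATAEC1994, Thm. V.3.1, Lemma V.5.1,
Thm. V.5.3 (PDF pp. 395–410)] [cite: Mochizuki2012, IUTchIV Thm. 1.10 p. 22] [claim: Mochizuki2012, status: disputed] for
every IUT quotation.
-/

noncomputable section

open NumberField IsDedekindDomain

namespace Summit.ABC.IUTFork.Conditional

open Thm311 Thm311.Real Cor312 Cor312Prov Literature.IUT.LogVolume Literature.IUT.HodgeTheaters
  Literature.IUT.LogThetaLattice Literature.NumberTheory.NumberFields Literature.NumberTheory.DiophantineGeometry.GenEll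
  Literature.NumberTheory.DiophantineGeometry Literature.NumberTheory.EllipticCurves

/-! ## 0. Arithmetic and the SPLIT test on the rational data -/

/-- The arithmetic of the two bounds WITHOUT the wild factor: `(p−1) ∣ A`, `15 ∣ A·t`, `A ∣ (p−1)p′` (and `A ∣ p − 1` when
`p′ ∣ t`) force `A = (p−1)·p′/gcd(p′, t)` for `{p, p′} = {3, 5}`. [folklore] -/
private theorem split_index_eq {p q t A : ℕ} (hpq : (p = 3 ∧ q = 5) ∨ (p = 5 ∧ q = 3))
    (h1 : (p - 1) ∣ A) (h15 : 15 ∣ A * t) (hup : A ∣ (p - 1) * q) (hup' : q ∣ t → A ∣ p - 1) :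
    A = (p - 1) * (q / Nat.gcd q t) := by
  rcases hpq with ⟨rfl, rfl⟩ | ⟨rfl, rfl⟩
  · have h2 : 2 ∣ A := by simpa using h1
    by_cases h5 : 5 ∣ t
    · have hA : A ∣ 2 := by simpa using hup' h5
      rw [Nat.gcd_eq_left h5]
      norm_num
      exact Nat.dvd_antisymm hA h2
    · have hcop : Nat.Coprime 5 t := (Nat.Prime.coprime_iff_not_dvd Nat.prime_five).mpr h5
      have h5A : 5 ∣ A := hcop.dvd_of_dvd_mul_right (dvd_trans (by norm_num) h15)
      have h10 : 10 ∣ A := Nat.Coprime.mul_dvd_of_dvd_of_dvd (by norm_num) h2 h5A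
      have hA : A ∣ 10 := by simpa using hup
      rw [Nat.Coprime.gcd_eq_one hcop]
      norm_num
      exact Nat.dvd_antisymm hA h10
  · have h4 : 4 ∣ A := by simpa using h1
    by_cases h3 : 3 ∣ t
    · have hA : A ∣ 4 := by simpa using hup' h3
      rw [Nat.gcd_eq_left h3]
      norm_num
      exact Nat.dvd_antisymm hA h4
    · have hcop : Nat.Coprime 3 t := (Nat.Prime.coprime_iff_not_dvd Nat.prime_three).mpr h3
      have h3A : 3 ∣ A := hcop.dvd_of_dvd_mul_right (dvd_trans (by norm_num) h15)
      have h12 : 12 ∣ A := Nat.Coprime.mul_dvd_of_dvd_of_dvd (by norm_num) h4 h3A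
      have hA : A ∣ 12 := by simpa using hup
      rw [Nat.Coprime.gcd_eq_one hcop]
      norm_num
      exact Nat.dvd_antisymm hA h12

/-- **The SPLIT test on the rational data pins the Tate parameter as a `p`-th power in `ℚ_v`.** At the place `v` of `ℚ`
with `p_v = p ≠ 2`, if `ord_v j(q₀) = −2t` with `p ∣ t` and the unit part `u = (j(q₀)⁻¹)/p^{2t}` satisfies `u^{p−1} = 1` or
`v_p(u^{p−1} − 1) ≥ 2`, then EVERY `q ∈ ℚ_v` with `q ≠ 0`, `|q|_v < 1`, `j(q) = j(q₀)` is a `p`-th power in `ℚ_v` — the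
hypothesis `hsplit` of `Cor22.ramificationIdx_subThetaField_dvd_split` at `F_tpd = ℚ` (this seat's
`exists_pow_prime_eq_of_tateJ_eq_adicCompletion_rat`, Serre II §3.3 with Silverman V.3.1 (b)).
[cite: Serre1973, Ch. II §3.3] [cite: SilvermanATAEC1994, Thm. V.3.1 (b), Lemma V.5.1 (PDF pp. 395, 406)] -/
theorem GenuineK.split_tateParameter_ratPoint {q₀ : ℚ} (v : HeightOneSpectrum (𝓞 ℚ)) {p : ℕ} (hp : p.Prime) (hp2 : p ≠ 2)
    (hvp : Rat.HeightOneSpectrum.natGenerator v = p) {t : ℕ} (ht : 0 < t) (hpt : p ∣ t)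
    (hpole : Literature.IUT.LogVolume.ord ℚ v (Cor22.jInv q₀) = -(2 * (t : ℤ)))
    (hunit : ((Cor22.jInv q₀)⁻¹ / (p : ℚ) ^ (2 * t)) ^ (p - 1) = 1 ∨
      2 ≤ padicValRat p ((((Cor22.jInv q₀)⁻¹ / (p : ℚ) ^ (2 * t)) ^ (p - 1) - 1))) :
    ∀ q : v.adicCompletion ℚ, q ≠ 0 → ‖q‖ < 1 → tateJ q = algebraMap ℚ (v.adicCompletion ℚ) (Cor22.jInv q₀) →
      ∃ y : v.adicCompletion ℚ, y ^ p = q := by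
  haveI : Fact p.Prime := ⟨hp⟩
  subst hvp
  set u : ℚ := (Cor22.jInv q₀)⁻¹ / (Rat.HeightOneSpectrum.natGenerator v : ℚ) ^ (2 * t) with hudef
  have hpQ : (Rat.HeightOneSpectrum.natGenerator v : ℚ) ≠ 0 := Nat.cast_ne_zero.mpr hp.ne_zero
  -- `j(q₀) ≠ 0` (a pole at `v`)
  have ht0 : (0 : ℤ) < t := by exact_mod_cast ht
  have hj0 : Cor22.jInv q₀ ≠ 0 := fun h0 => by
    rw [h0, Literature.IUT.LogVolume.ord_zero] at hpole
    linarith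
  have hju : (Cor22.jInv q₀)⁻¹ = (Rat.HeightOneSpectrum.natGenerator v : ℚ) ^ (2 * t) * u := by
    rw [hudef]; field_simp
  have hu0 : u ≠ 0 := by
    rw [hudef]
    exact div_ne_zero (inv_ne_zero hj0) (pow_ne_zero _ hpQ)
  -- `v_p(u) = 0`
  have hvj : padicValRat (Rat.HeightOneSpectrum.natGenerator v) (Cor22.jInv q₀) = -(2 * (t : ℤ)) := by
    rw [← GenuineK.ord_rat_eq_padicValRat v hj0]; exact hpole
  have hu : padicValRat (Rat.HeightOneSpectrum.natGenerator v) u = 0 := by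
    rw [hudef, padicValRat.div (inv_ne_zero hj0) (pow_ne_zero _ hpQ), padicValRat.inv, hvj, padicValRat.pow,
      padicValRat.self hp.one_lt]
    push_cast; ring
  -- the unit congruence as a norm bound
  have hunit' : padicNorm (Rat.HeightOneSpectrum.natGenerator v) (u ^ (Rat.HeightOneSpectrum.natGenerator v - 1) - 1) ≤
      (Rat.HeightOneSpectrum.natGenerator v : ℚ) ^ (-2 : ℤ) := by
    rcases hunit with h1 | h2
    · rw [h1, sub_self, padicNorm.zero]; positivity
    · have hne : u ^ (Rat.HeightOneSpectrum.natGenerator v - 1) - 1 ≠ 0 := by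
        intro h0
        rw [h0, padicValRat.zero] at h2
        exact absurd h2 (by norm_num)
      rw [padicNorm.eq_zpow_of_nonzero hne]
      exact zpow_le_zpow_right₀ (by exact_mod_cast hp.one_lt.le) (by linarith)
  intro q hq0 hq hqj
  exact exists_pow_prime_eq_of_tateJ_eq_adicCompletion_rat v hp2 hju hu0 hu (dvd_mul_of_dvd_right hpt 2) hunit'
    q hq0 hq hqj

/-! ## 1. The exact SPLIT type of the layer `F/ℚ` and of `K_{x₀}/ℚ_p` -/

/-- **`e(w | p) = (p − 1)·(p′/gcd(p′, t))` for every place `w ∣ p ∈ {3, 5}` of the field `F` of a genuine Θ-volume datum at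
`(ratPoint q₀, l)` over a SPLIT pole of `j(q₀)`** (order `2t`, `p ∣ t`, `u^{p−1} ≡ 1 (mod p²)`; `{p, p′} = {3, 5}`): the UPPER
bound of `Cor22.ramificationIdx_subThetaField_dvd_split` (`_of_dvd_ord` when `p′ ∣ t`) against the LOWER divisibilities
`(p−1) ∣ e` (`μ₃₀ ⊂ F`) and `15 ∣ e·t`. W-num-2's `e(F_w/ℚ_p) = e_W·r` with `e_W = p − 1` at a split packet.
[cite: Serre1972, §1.11–§1.12] [cite: Serre1973, Ch. II §3.3] [cite: Mochizuki2012, IUTchIV Thm. 1.10 p. 22]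
[claim: Mochizuki2012, status: disputed] -/
theorem GenuineK.ramificationIdx_F_eq_wildSplit_ratPoint {q₀ : ℚ} {l : ℕ} (T : Cor22.ThetaVolumeDatumAt (ratPoint q₀) l)
    {p p' : ℕ} (hpq : (p = 3 ∧ p' = 5) ∨ (p = 5 ∧ p' = 3)) {t : ℕ} (ht : 0 < t) (hpt : p ∣ t)
    (hpole : ∀ v : HeightOneSpectrum (𝓞 ℚ), Rat.HeightOneSpectrum.natGenerator v = p →
      Literature.IUT.LogVolume.ord ℚ v (Cor22.jInv q₀) = -(2 * (t : ℤ)))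
    (hunit : ((Cor22.jInv q₀)⁻¹ / (p : ℚ) ^ (2 * t)) ^ (p - 1) = 1 ∨
      2 ≤ padicValRat p ((((Cor22.jInv q₀)⁻¹ / (p : ℚ) ^ (2 * t)) ^ (p - 1) - 1)))
    (w : letI := T.instFieldF; letI := T.instNumberFieldF; HeightOneSpectrum (𝓞 T.F))
    (hw : letI := T.instFieldF; letI := T.instNumberFieldF; ((p : ℕ) : 𝓞 T.F) ∈ w.asIdeal) :
    (letI := T.instFieldF; letI := T.instNumberFieldF; w.asIdeal.ramificationIdx ℤ) =
      (p - 1) * (p' / Nat.gcd p' t) := by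
  letI := T.instFieldF; letI := T.instNumberFieldF; letI := T.instAlgebraF; letI := T.instFieldK
  letI := T.instNumberFieldK; letI := T.instAlgebraK; letI := T.instFieldFbar; letI := T.instAlgebraFbar
  letI := T.instAlgebraKFbar; letI := T.instIsElliptic
  have hp : p.Prime := by rcases hpq with ⟨rfl, -⟩ | ⟨rfl, -⟩ <;> norm_num
  have hp2 : p ≠ 2 := by rcases hpq with ⟨rfl, -⟩ | ⟨rfl, -⟩ <;> norm_num
  have hp30 : p ∣ 30 := by rcases hpq with ⟨rfl, -⟩ | ⟨rfl, -⟩ <;> norm_num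
  haveI : Fact p.Prime := ⟨hp⟩
  haveI : IsGalois (ratPoint q₀).F T.F := (T.towerFacts T.inU).1
  have ht0 : (0 : ℤ) < t := by exact_mod_cast ht
  -- the place `v₀` of `ℚ` under `w` is `p`
  set v₀ : HeightOneSpectrum (𝓞 ℚ) := finBelow (ratPoint q₀).F T.F w with hv₀def
  have hchar : residueChar ℚ v₀ = p := by
    rw [hv₀def]
    change residueChar (ratPoint q₀).F (finBelow (ratPoint q₀).F T.F w) = p
    rw [residueChar_finBelow]
    exact residueChar_eq_of_natCast_mem p hw
  have hpv : ((p : ℕ) : 𝓞 ℚ) ∈ v₀.asIdeal := (Cor22.natCast_mem_asIdeal_iff_residueChar_eq v₀ hp).2 hchar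
  have hvp : Rat.HeightOneSpectrum.natGenerator v₀ = p := by
    have hdvd := (UniformABCConjecture.natCast_mem_asIdeal_iff v₀ p).1 hpv
    exact (Nat.prime_dvd_prime_iff_eq (Rat.HeightOneSpectrum.prime_natGenerator v₀) hp).1 hdvd
  have hord := hpole v₀ hvp
  have hbad : v₀ ∈ Cor22.badPlaces (ratPoint q₀) :=
    (Cor22.mem_badPlaces_iff_ord_neg (ratPoint q₀) v₀).2 (by
      show Literature.IUT.LogVolume.ord ℚ v₀ (Cor22.jInv q₀) < 0
      rw [hord]; linarith)
  have hp1 : Literature.IUT.LogVolume.ord ℚ v₀ (p : ℚ) = 1 := by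
    rw [← hvp]
    exact Cor22.ord_natGenerator_eq_one v₀
  -- the SPLIT hypothesis at `v₀`
  have hsplit := GenuineK.split_tateParameter_ratPoint (q₀ := q₀) v₀ hp hp2 hvp ht hpt hord hunit
  -- `e(w | p) = e(w | v₀)` over `ℚ`
  have hew : w.asIdeal.ramificationIdx ℤ = w.asIdeal.ramificationIdx (𝓞 (ratPoint q₀).F) := by
    haveI : (finBelow (ratPoint q₀).F T.F w).asIdeal.IsMaximal := (finBelow (ratPoint q₀).F T.F w).isMaximal
    have h1 : ramIdx (ratPoint q₀).F (w.under (𝓞 (ratPoint q₀).F)) = 1 := by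
      rw [ramIdx_eq]
      exact Literature.NumberTheory.EllipticCurves.Fisher2016.ramificationIdx_int_rat_eq_one _
    rw [ThetaData.absRamificationIdx_eq_ramIdx_mul (F := (ratPoint q₀).F) w]
    erw [h1, one_mul]
    exact Ideal.ramificationIdx'_eq_ramificationIdx (finBelow (ratPoint q₀).F T.F w).asIdeal w.asIdeal
      (finBelow (ratPoint q₀).F T.F w).ne_bot
  -- UPPER: `e(w | v₀) ∣ (p−1)p′`, and `∣ p − 1` when `p′ ∣ t` — NO factor `p`
  have hup : w.asIdeal.ramificationIdx (𝓞 (ratPoint q₀).F) ∣ (p - 1) * p' :=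
    Cor22.ramificationIdx_subThetaField_dvd_split T.F T.inU T.isSubThetaField w hbad hpq hpv hp1 hsplit
  have hup' : p' ∣ t → w.asIdeal.ramificationIdx (𝓞 (ratPoint q₀).F) ∣ p - 1 := fun hqt =>
    Cor22.ramificationIdx_subThetaField_dvd_split_of_dvd_ord T.F T.inU T.isSubThetaField w hbad hpq hpv hp1 (by
      show ((p' : ℕ) : ℤ) ∣ Literature.IUT.LogVolume.ord ℚ v₀ (Cor22.jInv q₀)
      rw [hord, dvd_neg]
      exact dvd_mul_of_dvd_right (Int.natCast_dvd_natCast.mpr hqt) 2) hsplit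
  -- LOWER: `(p − 1) ∣ e(w | p)` and `15 ∣ e(w | v₀)·t`
  have h1 : (p - 1) ∣ w.asIdeal.ramificationIdx (𝓞 (ratPoint q₀).F) := by
    rw [← hew]
    exact T.sub_one_dvd_ramificationIdx_int hp hp30 w hw
  have h15 : 15 ∣ w.asIdeal.ramificationIdx (𝓞 (ratPoint q₀).F) * t :=
    T.fifteen_dvd_ramificationIdx_mul w (by rw [← hv₀def]; exact hord) ht
  rw [hew]
  exact split_index_eq hpq h1 h15 hup hup'

/-- **THE EXACT WILD LOCAL TYPE AT A SPLIT PACKET: `e(K_{x₀}/ℚ_p) = (p − 1)·(p′/gcd(p′, t))·l`** — no wild factor `p` — at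
every fibre point `x₀ ∣ p ∈ {3, 5}` (`p ≠ l`, `{p, p′} = {3, 5}`) of the pilot datum `pilotDataOfK T.D T.K` of a genuine Θ-volume
datum at `(ratPoint q₀, l)` over a pole of `j(q₀)` of order `2t` with `p ∣ t` and `u^{p−1} ≡ 1 (mod p²)`, `u = (j(q₀)⁻¹)/p^{2t}`:
the `l`-division layer contributes exactly `l` (`GenuineK.absRamificationIdx_kOf_eq_mul_prime_ratPoint`) over
`ramificationIdx_F_eq_wildSplit_ratPoint`. Closes the two-candidate residual `e ∈ {(p−1)rl, p(p−1)rl}` of GAP G-Wnum2-1 (i) at the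
SPLIT pole pairs of the abc-iut R-W window table: `e = l·(p−1)·r`, tame different `ord 𝔇 = e − 1`.
[cite: Serre1972, §1.11–§1.12] [cite: Serre1973, Ch. II §3.3] [cite: Mochizuki2012, IUTchI Ex. 3.2 (iv) p. 71; IUTchIV Thm. 1.10 p. 22]
[claim: Mochizuki2012, status: disputed] -/
theorem GenuineK.absRamificationIdx_kOf_eq_wildSplit_ratPoint {q₀ : ℚ} {l : ℕ} (T : Cor22.ThetaVolumeDatumAt (ratPoint q₀) l)
    (pp : Nat.Primes) {p' : ℕ} (hpq : ((pp : ℕ) = 3 ∧ p' = 5) ∨ ((pp : ℕ) = 5 ∧ p' = 3)) (hpl : (pp : ℕ) ≠ l)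
    {t : ℕ} (ht : 0 < t) (hpt : (pp : ℕ) ∣ t)
    (hpole : ∀ v : HeightOneSpectrum (𝓞 ℚ), Rat.HeightOneSpectrum.natGenerator v = pp →
      Literature.IUT.LogVolume.ord ℚ v (Cor22.jInv q₀) = -(2 * (t : ℤ)))
    (hunit : ((Cor22.jInv q₀)⁻¹ / ((pp : ℕ) : ℚ) ^ (2 * t)) ^ ((pp : ℕ) - 1) = 1 ∨
      2 ≤ padicValRat pp ((((Cor22.jInv q₀)⁻¹ / ((pp : ℕ) : ℚ) ^ (2 * t)) ^ ((pp : ℕ) - 1) - 1))) :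
    letI := T.instFieldF; letI := T.instNumberFieldF; letI := T.instAlgebraF; letI := T.instFieldK
    letI := T.instNumberFieldK; letI := T.instAlgebraK; letI := T.instFieldFbar; letI := T.instAlgebraFbar
    letI := T.instAlgebraKFbar; letI := T.instIsElliptic
    haveI : Fact (pp : ℕ).Prime := ⟨pp.2⟩
    ∀ x₀ : (thetaIndex (pilotDataOfK T.D T.K)).Fibre (.inr pp),
      absRamificationIdx (pp : ℕ) (kOf (pilotDataOfK T.D T.K) pp.1 x₀) = (pp - 1) * (p' / Nat.gcd p' t) * l := by
  letI := T.instFieldF; letI := T.instNumberFieldF; letI := T.instAlgebraF; letI := T.instFieldK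
  letI := T.instNumberFieldK; letI := T.instAlgebraK; letI := T.instFieldFbar; letI := T.instAlgebraFbar
  letI := T.instAlgebraKFbar; letI := T.instIsElliptic
  haveI : Fact (pp : ℕ).Prime := ⟨pp.2⟩
  have hp2 : (pp : ℕ) ≠ 2 := by rcases hpq with ⟨h, -⟩ | ⟨h, -⟩ <;> omega
  have hpole' : ∀ v : HeightOneSpectrum (𝓞 ℚ), Rat.HeightOneSpectrum.natGenerator v = pp →
      Literature.IUT.LogVolume.ord ℚ v (Cor22.jInv q₀) < 0 := fun v hv => by
    rw [hpole v hv]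
    have : (0 : ℤ) < t := by exact_mod_cast ht
    linarith
  set X := pilotDataOfK T.D T.K with hXdef
  intro x₀
  rw [GenuineK.absRamificationIdx_kOf_eq_mul_prime_ratPoint T pp hp2 hpl hpole' x₀]
  set u := placeOf X pp.1 x₀ with hudef
  have hpu : ((pp : ℕ) : 𝓞 T.K) ∈ u.asIdeal := natCast_mem_placeOf X pp.1 x₀
  have hw : ((pp : ℕ) : 𝓞 T.F) ∈ (finBelow T.F T.K u).asIdeal := by
    rw [Cor22.natCast_mem_asIdeal_iff_residueChar_eq _ pp.2, residueChar_finBelow]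
    exact residueChar_eq_of_natCast_mem pp.1 hpu
  rw [GenuineK.ramificationIdx_F_eq_wildSplit_ratPoint T hpq ht hpt hpole hunit (finBelow T.F T.K u) hw]

end Summit.ABC.IUTFork.Conditional

end
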